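import Mathlib
import Summits.KontsevichZagierPeriods.KontsevichZagierPeriods.Theses.IsogenyCertificates

/-!
# Sketch — first lemmas of the crux ideas for `XMapPeriodTransfer` (stmt-KontsevichZagierPeriods-10665)

crux-ideate round 1, ideator 2 (planner-cruxidea-stmt-KontsevichZagierPeriods-10665-2-0).

Cards:
* `whole-component-sheets` — first lemma `SheetExact` (+ `SheetMove`, `EggSwap`);
* `sheet-stacking-fubini` — first lemma `StackedMove` (+ transfer `UniformChainLength`, with the two
  corollaries `xMapPeriodTransfer_of_uniformChainLength` and
  `effectiveXMapChains_of_uniformChainLength` PROVED here: the rank-2 crux of the route follows from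
  the transfer with `(C, k) = (16, 0)` and WITHOUT its Masser–Wüstholz-type hypothesis).

Statements are over `Literature.NumberTheory.Transcendental.KZCalculus` and Mathlib only; the small
`def`s below (`cubic`, `xmap`, `wr`, `sheetLocus`, `IsDatum`, `fibreCount`) are abbreviations of
expressions occurring verbatim in the crux.
-/

namespace Summit.KontsevichZagierPeriods.KontsevichZagierPeriods.Cruxes.XMapPeriodTransfer.Sketch

open Literature.NumberTheory.Transcendental Polynomial Set
open Summit.KontsevichZagierPeriods.KontsevichZagierPeriods.Theses.IsogenyCertificates

noncomputable section

/-- The real cubic `P(x) = x³ + A x + B`. -/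
def cubic (A B : ℤ) (x : ℝ) : ℝ := x ^ 3 + (A : ℝ) * x + (B : ℝ)

/-- The x-map `R = f/g` of the datum, read on `ℝ`. -/
def xmap (f g : ℚ[X]) (x : ℝ) : ℝ := aeval x f / aeval x g

/-- The Wronskian numerator `W = f′g − fg′` of `R′ = W/g²` (verbatim the crux's expression). -/
def wr (f g : ℚ[X]) : ℚ[X] := derivative f * g - f * derivative g

/-- The SHEET LOCUS `U = {P > 0} ∖ Z(g·W)`: its connected components are the sheets. -/
def sheetLocus (A B : ℤ) (f g : ℚ[X]) : Set ℝ :=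
  {x | 0 < cubic A B x ∧ aeval x g ≠ 0 ∧ aeval x (wr f g) ≠ 0}

/-- The crux's hypothesis on `(f, g, c)` (verbatim shape): `W ≠ 0` and
`c²·g·(f³ + A′fg² + B′g³) = (X³ + AX + B)·W²`. -/
def IsDatum (A B A' B' : ℤ) (f g : ℚ[X]) (c : ℚ) : Prop :=
  wr f g ≠ 0 ∧
    C (c ^ 2) * g * (f ^ 3 + C (A' : ℚ) * f * g ^ 2 + C (B' : ℚ) * g ^ 3) =
      (X ^ 3 + C (A : ℚ) * X + C (B : ℚ)) * (wr f g) ^ 2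

/-- Real fibre cardinality of the x-map over `X`: `#{x ∈ U | R x = X}` (finite: `R` is non-constant). -/
def fibreCount (A B : ℤ) (f g : ℚ[X]) (X : ℝ) : ℕ :=
  Nat.card {x : ℝ // x ∈ sheetLocus A B f g ∧ xmap f g x = X}

/-! ## Card `whole-component-sheets` -/

/-- **First lemma (`SheetExact`).** For a COPRIME datum, the x-map is strictly monotone on every sheet
(connected component of `U = {P>0} ∖ Z(gW)`) and maps it onto a WHOLE connected component of `{P′ > 0}`:
both end-limits of `R` on a sheet lie in `Z(P′) ∪ {±∞}` — at a zero of `W` or of `P` with `g ≠ 0` the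
identity gives `P′(R) = P W²/(c²g⁴) = 0`; at a zero of `g` coprimality gives `|R| → ∞`; at `+∞` a finite
limit `L` with `P′(L) ≠ 0` would make the polynomial `c²g·(f³+A′fg²+B′g³) = c²g⁴·P′(R)` of EVEN degree
`4 deg g`, while it equals `P·W²` of ODD degree `3 + 2 deg W`. -/
def SheetExact : Prop :=
  ∀ (A B A' B' : ℤ), 4 * A ^ 3 + 27 * B ^ 2 ≠ 0 → 4 * A' ^ 3 + 27 * B' ^ 2 ≠ 0 →
  ∀ (f g : ℚ[X]) (c : ℚ), IsCoprime f g → IsDatum A B A' B' f g c →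
  ∀ x₀ ∈ sheetLocus A B f g,
    (StrictMonoOn (xmap f g) (connectedComponentIn (sheetLocus A B f g) x₀) ∨
      StrictAntiOn (xmap f g) (connectedComponentIn (sheetLocus A B f g) x₀)) ∧
    xmap f g '' connectedComponentIn (sheetLocus A B f g) x₀ =
      connectedComponentIn {X | 0 < cubic A' B' X} (xmap f g x₀)

/-- **One rule-2) move per sheet (`SheetMove`).** With `SheetExact`, each sheet `I ∋ x₀` carries the
representation `[I, a/√P]` onto `[R(I), (a/|c|)/√P′]`, `R(I)` a whole component of `{P′>0}`, by ONE
`changeOfVariablesRel` instance `Φ = R` (`|Φ′| = |W|/g²`, and `√(P′∘R) = √P·|W|/(|c| g²)` on `I`). -/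
def SheetMove : Prop :=
  ∀ (A B A' B' : ℤ), 4 * A ^ 3 + 27 * B ^ 2 ≠ 0 → 4 * A' ^ 3 + 27 * B' ^ 2 ≠ 0 →
  ∀ (f g : ℚ[X]) (c : ℚ), IsCoprime f g → IsDatum A B A' B' f g c → ∀ (a : ℚ), 0 < a →
  ∀ x₀ ∈ sheetLocus A B f g, ∀ (s s' : KZ.IntegralRep 1),
    s.domain = {x | x 0 ∈ connectedComponentIn (sheetLocus A B f g) x₀} →
    EqOn s.integrand (fun x => (a : ℝ) / Real.sqrt (cubic A B (x 0))) s.domain →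
    s'.domain = {x | x 0 ∈ connectedComponentIn {X | 0 < cubic A' B' X} (xmap f g x₀)} →
    EqOn s'.integrand (fun x => (a : ℝ) / |(c : ℝ)| / Real.sqrt (cubic A' B' (x 0))) s'.domain →
    KZ.of s - KZ.of s' ∈ KZ.changeOfVariablesRel

/-- **The egg ↔ unbounded swap (`EggSwap`), general form of the template of stmt-8773.** For a target
cubic with three real roots `e₁ < e₂ < e₃`, translation by the 2-torsion point `(e₁, 0)` acts on `x` by the
Möbius map `M(X) = e₁ + (e₁−e₂)(e₁−e₃)/(X − e₁)`, a decreasing bijection `(e₁,e₂) → (e₃,∞)` with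
`P′(M X) = P′(X)·M′(X)²` (translation by `(e₂, 0)`, `X ↦ e₂ + (e₂−e₁)(e₂−e₃)/(X − e₂)`, increasing, does the
same job; when one of `e₁, e₂` is rational that one has rational coefficients); its graph is `ℚ`-semialgebraic (the `eᵢ` are `ℚ`-definable; Tarski–Seidenberg,
`tarski_seidenberg_holds`), so `[egg′, h/√P′] − [unb′, h/√P′]` is ONE `changeOfVariablesRel` instance. Its
SOUNDNESS (`KZ.eval_eq_zero_of_mem_changeOfVariablesRel_holds`) replaces every evaluation of elliptic
integrals in the line (`∫_egg′ = ∫_unb′` is never computed). -/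
def EggSwap : Prop :=
  ∀ (A' B' : ℤ) (e₁ e₂ e₃ : ℝ), e₁ < e₂ → e₂ < e₃ →
    (∀ X, cubic A' B' X = (X - e₁) * (X - e₂) * (X - e₃)) →
  ∀ (h : ℚ) (s s' : KZ.IntegralRep 1),
    s.domain = {x | x 0 ∈ Ioo e₁ e₂} →
    EqOn s.integrand (fun x => (h : ℝ) / Real.sqrt (cubic A' B' (x 0))) s.domain →
    s'.domain = {x | e₃ < x 0} →
    EqOn s'.integrand (fun x => (h : ℝ) / Real.sqrt (cubic A' B' (x 0))) s'.domain →
    KZ.of s - KZ.of s' ∈ KZ.changeOfVariablesRel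

/-! ## Card `sheet-stacking-fubini` -/

/-- **First lemma (`StackedMove`): all sheets in ONE change of variables.** Lift to the planar region
INSIDE the real curve, `{x ∈ U, 0 < s, s² < P(x)}` with the RATIONAL integrand `a/P(x)` (one Newton–Leibniz
move with primitive `F = a·s/P(x)` does this), and map it by
`Ψ(x, s) = (R(x), (k(x) + s/√P(x))·√(P′(R x)))`, where `k(x) ∈ ℕ` numbers the sheet of `x` among the sheets
lying over the same target component: the first coordinate and, for `k = 0`, the second (`= s·|R′(x)|/|c|`)
are the isogeny's own affine formula `(x, y) ↦ (R(x), y R′(x)/c)`; `|det Ψ′| = W²/(|c| g⁴)`, so the integrand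
identity `a/P = (a/(|c| P′∘R))·|det Ψ′|` IS the datum identity; `Ψ` is injective (integer part of `s′/√P′` =
sheet number, fractional part = `s/√P`) and, by `SheetExact`, its image is the STACK
`{0 < P′(X), 0 < s′ < m(X)·√P′(X), s′/√P′(X) ∉ ℕ}`, `m` = real fibre cardinality. One `changeOfVariablesRel`
instance; a downward Newton–Leibniz move then ADDS the `m(X)` layers (Fubini performs the `N`-fold sum). -/
def StackedMove : Prop :=
  ∀ (A B A' B' : ℤ), 4 * A ^ 3 + 27 * B ^ 2 ≠ 0 → 4 * A' ^ 3 + 27 * B' ^ 2 ≠ 0 →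
  ∀ (f g : ℚ[X]) (c : ℚ), IsCoprime f g → IsDatum A B A' B' f g c → ∀ (a : ℚ), 0 < a →
  ∀ (s s' : KZ.IntegralRep 2),
    s.domain = {z | z 0 ∈ sheetLocus A B f g ∧ 0 < z 1 ∧ z 1 ^ 2 < cubic A B (z 0)} →
    EqOn s.integrand (fun z => (a : ℝ) / cubic A B (z 0)) s.domain →
    s'.domain = {w | 0 < cubic A' B' (w 0) ∧ 0 < w 1 ∧
        w 1 < (fibreCount A B f g (w 0) : ℝ) * Real.sqrt (cubic A' B' (w 0)) ∧
        ∀ k : ℕ, w 1 ≠ (k : ℝ) * Real.sqrt (cubic A' B' (w 0))} →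
    EqOn s'.integrand (fun w => (a : ℝ) / (|(c : ℝ)| * cubic A' B' (w 0))) s'.domain →
    KZ.of s - KZ.of s' ∈ KZ.changeOfVariablesRel

/-- **Transfer `C⁺` (`UniformChainLength`): the crux WITH a uniform bound on the number of moves.** Same
binders as `XMapPeriodTransfer`; conclusion: a chain of at most `16` signed move instances, for every
isogeny datum of every degree (up + null + stacked move + null/split + 2 down + swap/merge/split/swap/merge
+ identity). -/
def UniformChainLength : Prop :=
  ∀ (A B A' B' : ℤ), 4 * A ^ 3 + 27 * B ^ 2 ≠ 0 → 4 * A' ^ 3 + 27 * B' ^ 2 ≠ 0 →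
  ∀ (f g : Polynomial ℚ) (c : ℚ), Polynomial.derivative f * g - f * Polynomial.derivative g ≠ 0 →
  Polynomial.C (c ^ 2) * g * (f ^ 3 + Polynomial.C (A' : ℚ) * f * g ^ 2 + Polynomial.C (B' : ℚ) * g ^ 3) =
    (Polynomial.X ^ 3 + Polynomial.C (A : ℚ) * Polynomial.X + Polynomial.C (B : ℚ)) *
      (Polynomial.derivative f * g - f * Polynomial.derivative g) ^ 2 →
  ∀ (a b : ℚ), 0 < a → 0 < b → ∀ (r r' : KZ.IntegralRep 1),
    r.domain = {x | 0 < x 0 ^ 3 + (A : ℝ) * x 0 + (B : ℝ)} →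
    Set.EqOn r.integrand (fun x => (a : ℝ) / Real.sqrt (x 0 ^ 3 + (A : ℝ) * x 0 + (B : ℝ))) r.domain →
    r'.domain = {x | 0 < x 0 ^ 3 + (A' : ℝ) * x 0 + (B' : ℝ)} →
    Set.EqOn r'.integrand (fun x => (b : ℝ) / Real.sqrt (x 0 ^ 3 + (A' : ℝ) * x 0 + (B' : ℝ))) r'.domain →
    r.value = r'.value →
    ∃ l : List KZ.FormalRep, l.length ≤ 16 ∧
      (∀ x ∈ l, x ∈ (KZ.domainAddRel ∪ KZ.integrandAddRel ∪ KZ.changeOfVariablesRel ∪ KZ.newtonLeibnizRel) ∨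
        -x ∈ (KZ.domainAddRel ∪ KZ.integrandAddRel ∪ KZ.changeOfVariablesRel ∪ KZ.newtonLeibnizRel)) ∧
      l.sum = KZ.of r - KZ.of r'

/-- The transfer decides the crux (pure bookkeeping: a sum of signed generators lies in `KZ.relations`). -/
theorem xMapPeriodTransfer_of_uniformChainLength (h : UniformChainLength) : XMapPeriodTransfer := by
  intro A B A' B' hΔ hΔ' f g c hW hI a b ha hb r r' h1 h2 h3 h4 h5
  obtain ⟨l, -, hmem, hsum⟩ := h A B A' B' hΔ hΔ' f g c hW hI a b ha hb r r' h1 h2 h3 h4 h5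
  show KZ.of r - KZ.of r' ∈ KZ.relations
  rw [← hsum]
  refine KZ.relations.list_sum_mem fun x hx => ?_
  rcases hmem x hx with hx' | hx'
  · exact AddSubgroup.subset_closure hx'
  · exact (KZ.relations.neg_mem_iff).mp (AddSubgroup.subset_closure hx')

/-- The transfer also closes the route's rank-2 crux `EffectiveXMapChains`, with `(C, k) = (16, 0)` and
WITHOUT using its effective-isogeny hypothesis: word length in `KZ.relations` does not see the isogeny
degree at all (it is absorbed in the semialgebraic complexity of ONE move). -/
theorem effectiveXMapChains_of_uniformChainLength (h : UniformChainLength) : EffectiveXMapChains := by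
  intro _
  refine ⟨16, 0, ?_⟩
  intro A B A' B' hΔ hΔ' _ a b ha hb r r' h1 h2 h3 h4 h5
  -- the datum is needed: EffectiveXMapChains supplies one existentially
  rename_i hex
  obtain ⟨f, g, c, hW, hI⟩ := hex
  obtain ⟨l, hl, hmem, hsum⟩ := h A B A' B' hΔ hΔ' f g c hW hI a b ha hb r r' h1 h2 h3 h4 h5
  refine ⟨l, ?_, hmem, hsum⟩
  rw [Real.rpow_zero, mul_one]
  exact_mod_cast hl

/-! ## Calibrations (all data rational in the statement; the natural chain needs IRRATIONAL cuts/swaps) -/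

/-- The datum `(f, g, c) = (X² + 2, X, 1)` from `(A,B) = (2,0)` (Δ < 0, `E(ℝ)` connected) to
`(A′,B′) = (−8,0)` (roots `0, ±2√2`): Vélu's 2-isogeny `y² = x³ + 2x → Y² = X³ − 8X`. Checked by `ring`. -/
theorem isDatum_twoZeroMinusEightZero : IsDatum 2 0 (-8) 0 (X ^ 2 + 2) X 1 := by
  refine ⟨?_, ?_⟩
  · unfold wr
    simp only [derivative_add, derivative_X_pow, derivative_ofNat, derivative_X, add_zero, mul_one]
    intro h
    have := congrArg (fun p : ℚ[X] => p.eval 0) h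
    norm_num at this
  · unfold wr
    simp only [derivative_add, derivative_X_pow, derivative_ofNat, derivative_X, add_zero, mul_one,
      one_pow, map_one, Int.cast_zero, map_zero, Int.cast_neg, map_neg, Int.cast_ofNat, map_natCast,
      Nat.cast_ofNat, Polynomial.C_ofNat]
    ring

/-- **Calibration (`IrrationalSheetCalibration`).** `∫_{x³+2x>0} dx/√(x³+2x) = ∫_{X³−8X>0} dX/√(X³−8X)`
as KZ-equivalence: the x-map `x + 2/x` has its turning point at `x = √2` (IRRATIONAL cut, forced by
injectivity of rule 2)), both sheets `(0,√2)`, `(√2,∞)` land on the unbounded component `(2√2, ∞)`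
(`m_unb = 2`, `m_egg = 0`), and matching `r′` needs one egg ↔ unbounded swap, which here can be taken
RATIONAL: translation by the egg point `(0, 0)` acts by `X ↦ −8/X`, `(−2√2, 0) → (2√2, ∞)`. The smallest
instance exercising every semialgebraic-bookkeeping step of the line with all four numbers `A, B, A′, B′`
integral and `a = b = 1` (kit j008618 row `velu2(b=2)`: EXACT, value identity to 9e-32). -/
def IrrationalSheetCalibration : Prop :=
  ∀ (r r' : KZ.IntegralRep 1), r.domain = {x | 0 < x 0 ^ 3 + 2 * x 0} →
    Set.EqOn r.integrand (fun x => 1 / Real.sqrt (x 0 ^ 3 + 2 * x 0)) r.domain →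
    r'.domain = {x | 0 < x 0 ^ 3 - 8 * x 0} →
    Set.EqOn r'.integrand (fun x => 1 / Real.sqrt (x 0 ^ 3 - 8 * x 0)) r'.domain →
    KZ.Equivalent r r'

end

end Summit.KontsevichZagierPeriods.KontsevichZagierPeriods.Cruxes.XMapPeriodTransfer.Sketch
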